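import Summits.PneNP.PneNP.Theorems.ChebyshevTracialDesignTiltedJuntaAverage
import Summits.PneNP.PneNP.Theorems.ChebyshevTracialDesignTiltedSmallBlockAllDirections
import HarnessLib

/-!
# Cell pnp-psdrank, route `ChebyshevTracialDesign`: (CG_1′) AND THE 𝒜₁ RUNG FOR EVERY JUNTA MASK ON ≤ √n/4 COORDINATES, ALL DIRECTIONS,
# EVERY DIMENSION (brick J5b = 163d; crux `TracialDecayExp20`, stmt-PneNP-19878)

Brick 163d (prover g31; MEMO-34 §6; the junta form of bricks 155/156/161). With brick 163a's `identityColour_facts` (colour `H` by the identity (`p ↦ p+1`) and the rest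
by `0`; a colour-preserving permutation fixes `H` pointwise, so `U ↦ f(U∩H)` is colour-symmetric for EVERY junta `f`, and a colour-type-constant field
is constant on the vertices of the edges outside `H` — exactly the directions priced by brick 163c), for some `a > 0` and all large even `n`,
every balanced `B = 20` Chebyshev design `(t,C,w)`, every block `4|H| ≤ ⌊√n⌋` and every junta mask `0 ≤ f ≤ G` of the in-set:
* **`junta_containment_allDirections_decay`** — for EVERY direction field `v : PM_n → [n] → [−1,1]`:
  `Σ_M (Σ_U W(U,M)·f(U∩H)·(Σ_p v_M(p)x_px_{π_Mp})²)₊ ≤ 20G((4|H|+t+5Tq n+4)² + (|H|+1)n²)(1/3)^{⌊dq n/2⌋−1} + 160Gn⁶e^{−a·dq n}`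
  (brick 148 §4 `colourSymmetric_allDirections_reduction`; `junta_allDirections_pairSymm_le` is the pair-symmetric step);
* **`junta_amplitudeOne_value_le_of_sqrt`** — for every degree-one Gram contraction `B_U = Σ_p x_p(U)β_p` (`B_UB_Uᵀ ⪯ I` on the `t`-cuts) and every
  psd contraction field `0 ⪯ Y_M ⪯ I` of dimension `r`:
  `Σ_{U,M} W·f(U∩H)·tr(B_UB_UᵀY_M) ≤ 8·(20G((4|H|+t+5Tq n+4)² + (|H|+1)n²)(1/3)^{⌊dq n/2⌋−1} + 160Gn⁶e^{−a·dq n} + 60Gn⁴√P_{dq n−4})·r`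
  (brick 150b `colourSymmetric_amplitudeOne_of_typeConstant`; `junta_amplitudeOne_value_le` is the parametrised form).
READING (MEMO-34 §6): the junta cells of (CG_1′)/𝒜₁ were priced up to size `≍ dq n·ln n` (bricks 113–116, `8^{|J|}(8|J|/√n)^{dq n}`); the tilted
small-block method reaches EVERY junta mask on `≤ √n/4` coordinates at rate `3^{−dq n/2}`, subsuming bricks 155/156 (block-count masks) and 161
(two blocks). The open heart of the crux is unchanged: spread / non-junta masks (N2).
[cite: Rothvoss2017, §2 and Lemma 7 (PDF pp. 5–8)] [cite: GriblingDelaatLaurent2019, §5] [cite: KeevashLifshitz2023, Thm. 1.8]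
Stature: support/instrument (kernel lane, no defs, axioms standard). WHAT THIS IS NOT: nothing on spread / non-junta masks (the open heart, N2), no proof or refutation of
`TracialDecayExp20`, nothing on psd rank of P_PM(K_n), no P-vs-NP content. Supports stmt-PneNP-19878.
-/

set_option linter.dupNamespace false -- `Summit.PneNP.PneNP.…`: summit = sub-problem (D-0017)

noncomputable section

namespace Summit.PneNP.PneNP.Theorems.ChebyshevTracialDesignTiltedJuntaRungs

open Finset Matrix Literature.Barriers.PneNP Literature.Combinatorics.Optimization
open Summit.PneNP.PneNP.Theorems.ChebyshevTracialDesignColourSymmetricAmplitudeOne (colourSymmetric_amplitudeOne_of_typeConstant)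
open Summit.PneNP.PneNP.Theorems.ChebyshevTracialDesignColourSymmetricReduction (colourSymmetric_allDirections_reduction)
open Summit.PneNP.PneNP.Theorems.ChebyshevTracialDesignUnconditionalRungs (rectangleDecayExp_all_holds)
open Summit.PneNP.PneNP.Theorems.ChebyshevTracialDesignAllDirections (abs_classAvg_le_one)
open Summit.PneNP.PneNP.Theorems.ChebyshevTracialDesignHSymmetricAmplitudeOne (containment_pairSymm)
open Summit.PneNP.PneNP.Theorems.ChebyshevTracialDesignTiltedSmallBlockAmplitudeOne (card_map_inter_eq dq_facts
  sqrt_block_admissible)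
open Summit.PneNP.PneNP.Theorems.ChebyshevTracialDesignTiltedJuntaAverage (tilted_designValue_avg_le_three_pow_J)
open Summit.PneNP.PneNP.Theorems.ChebyshevTracialDesignTiltedJuntaClassSplit (identityColour_facts)

variable {n : ℕ}

/-! ### §1 The 𝒜₁ rung for junta masks on small blocks -/

/-- **THE 𝒜₁ RUNG FOR JUNTA MASKS ON SMALL BLOCKS (brick J5b).** There are `a > 0` and `n₀` such that for all even `n ≥ n₀`, every
balanced `B = 20` Chebyshev design `(t, C, w)`, every block `H` with `|H| = h`, `9h(h+1) ≤ n − 2h + 1`, an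
admissible `R` (as brick 154), every junta mask `0 ≤ f ≤ G` of the in-set, every degree-one Gram contraction `B_U = Σ_p x_p(U)β_p` (`B_UB_Uᵀ ⪯ I` on
the `t`-cuts) and every psd contraction field `0 ⪯ Y_M ⪯ I` of dimension `r`:
`Σ_{U,M} W(U,M)·f(U∩H)·tr(B_UB_UᵀY_M) ≤ 8·(20G((4h+t+5Tq n+4)² + (h+1)n²)(1/3)^{⌊dq n/2⌋−1} + 160Gn⁶e^{−a·dq n} + 60Gn⁴√P_{dq n−4})·r`
(brick 150b with the identity colouring of `H`, `Btc` := brick J5a). [cite: Rothvoss2017, §2 (PDF pp. 5–6)] [cite: GriblingDelaatLaurent2019, §5] -/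
theorem junta_amplitudeOne_value_le :
    ∃ a : ℝ, 0 < a ∧ ∃ n₀ : ℕ, ∀ n : ℕ, n₀ ≤ n → Even n → ∀ {t : ℕ} {C : Finset ℕ} {w : ℕ → ℝ},
    IsBalancedDesign n t (Tq n) (dq n) 20 C w →
    ∀ (H : Finset (Fin n)) {h s₀ R : ℕ}, H.card = h → 9 * (h * (h + 1)) ≤ n - 2 * h + 1 →
      t = 2 * s₀ + 1 → 1 ≤ R →
      R + 3 * (dq n + 1) + h + (Tq n - 1) / 2 ≤ s₀ → R + 3 * (dq n + 1) + h + s₀ + (Tq n - 1) / 2 + 2 ≤ n / 2 →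
      ((h : ℝ) / R) ^ 2 * Real.exp (3 * h / R) ≤ 2 →
      ((((Tq n - 1) / 2 : ℕ)) : ℝ) * ((1 / 4 : ℝ) * ((h : ℝ) / R) ^ 2 * Real.exp (3 * h / R)) ≤ 1 / 9 →
    ∀ (f : Finset (Fin n) → ℝ) {G : ℝ}, (∀ I, |f I| ≤ G) → (∀ I, 0 ≤ f I) →
    ∀ {r m : ℕ} (β : Fin n → Matrix (Fin r) (Fin m) ℝ),
    (∀ U : OddSet n, U.1.card = t →
      (1 - (∑ p, (if p ∈ U.1 then (1 : ℝ) else 0) • β p) * (∑ p, (if p ∈ U.1 then (1 : ℝ) else 0) • β p)ᵀ).PosSemidef) →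
    ∀ (Y : PMatch n → Matrix (Fin r) (Fin r) ℝ), (∀ M, (Y M).PosSemidef ∧ (1 - Y M).PosSemidef) →
    ∑ U : OddSet n, ∑ M : PMatch n, levelWeight n t C w U M *
        (f (U.1 ∩ H) *
          ((∑ p, (if p ∈ U.1 then (1 : ℝ) else 0) • β p) * (∑ p, (if p ∈ U.1 then (1 : ℝ) else 0) • β p)ᵀ * Y M).trace) ≤
      8 * (20 * G * ((4 * (h : ℝ) + t + 5 * (Tq n) + 4) ^ 2 + ((h : ℝ) + 1) * (n : ℝ) ^ 2) * (1 / 3 : ℝ) ^ (dq n / 2 - 1) +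
        160 * G * (n : ℝ) ^ 6 * Real.exp (-(a * dq n)) +
        60 * G * (n : ℝ) ^ 4 * Real.sqrt (∏ i ∈ range ((dq n - 4) / 2 + 1), ((2 * i + 1 : ℝ) / ((n : ℝ) - 2 * i)))) * r := by
  classical
  obtain ⟨a, ha, n₀, h150⟩ := colourSymmetric_amplitudeOne_of_typeConstant
  refine ⟨a, ha, max n₀ 256, ?_⟩
  intro n hn heven t C w hbal H h s₀ R hh h9 ht hR hR1 hR2 hq hθ f G hG hf0 r m β hβ Y hY
  have hn₀ : n₀ ≤ n := le_trans (le_max_left _ _) hn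
  have h256 : 256 ≤ n := le_trans (le_max_right _ _) hn
  obtain ⟨hD4, hDT⟩ := dq_facts h256
  have hdes : IsExactDesign n t (Tq n) (dq n) 20 C w := hbal.1
  have hG0 : 0 ≤ G := (abs_nonneg _).trans (hG ∅)
  have hN : (univ : Finset (Fin n)).card = 2 * (n / 2) := by
    rw [card_univ, Fintype.card_fin]; obtain ⟨k, hk⟩ := heven; omega
  have h2h : 2 * h ≤ n := by omega
  -- the colouring and the mask
  obtain ⟨col, hc0, hcfix, htc⟩ := identityColour_facts H
  set fU : Finset (Fin n) → ℝ := fun U => f (U ∩ H) with hf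
  have hf0' : ∀ U, 0 ≤ fU U := fun U => hf0 _
  have hfG : ∀ U, fU U ≤ G := fun U => (le_abs_self _).trans (hG _)
  have hfinv : ∀ (M : PMatch n) (g : Equiv.Perm (Fin n)), (∀ i, g (M.2.partner i) = M.2.partner (g i)) →
      (∀ i, col (g i) = col i) → ∀ U : Finset (Fin n), fU (U.map g.toEmbedding) = fU U := by
    intro M g _ hg U
    rw [hf]
    simp only
    rw [hcfix g hg U]
  -- the colour-type-constant bound from brick J5a
  have hBtc : ∀ v : PMatch n → Fin n → ℝ, (∀ M p, |v M p| ≤ 1) →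
      (∀ M p p', s(col p, col (M.2.partner p)) = s(col p', col (M.2.partner p')) → v M p = v M p') →
      ∑ M : PMatch n, ∑ U : OddSet n, levelWeight n t C w U M * (fU U.1 *
        (∑ p : Fin n, v M p * ((if p ∈ U.1 then (1 : ℝ) else 0) * (if M.2.partner p ∈ U.1 then (1 : ℝ) else 0))) ^ 2) ≤
      20 * G * ((4 * (h : ℝ) + t + 5 * (Tq n) + 4) ^ 2 + ((h : ℝ) + 1) * (n : ℝ) ^ 2) * (1 / 3 : ℝ) ^ (dq n / 2 - 1) := by
    intro v hv hvt
    have h160 := tilted_designValue_avg_le_three_pow_J hdes hN H hh h9 h2h ht hD4 hDT hR hR1 hR2 hq hθ f hG hf0 v hv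
      (fun M => htc M.2.partner (v M) (hvt M))
    simpa only [hf] using h160
  have hmain := h150 n hn₀ heven hbal col fU hG0 hf0' hfG hfinv hBtc β hβ Y hY
  simpa only [hf] using hmain

/-- **THE 𝒜₁ RUNG FOR JUNTA MASKS ON BLOCKS OF TOTAL SIZE `≤ √n/4` (turnkey form).** For some `a > 0` and all large even `n`: every
balanced `B = 20` Chebyshev design `(t, C, w)`, every block `H` with `4|H| ≤ ⌊√n⌋`, every junta mask `0 ≤ f ≤ G` of the in-set,
every degree-one Gram contraction with `B_UB_Uᵀ ⪯ I` on the `t`-cuts and every psd contraction field `0 ⪯ Y_M ⪯ I` of dimension `r`: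
`Σ_{U,M} W·f(U∩H)·tr(B_UB_UᵀY_M) ≤ 8·(20G((4|H|+t+5Tq n+4)² + (|H|+1)n²)(1/3)^{⌊dq n/2⌋−1} + 160Gn⁶e^{−a·dq n} + 60Gn⁴√P_{dq n−4})·r`.
[cite: Rothvoss2017, §2 (PDF pp. 5–6)] [cite: GriblingDelaatLaurent2019, §5] -/
theorem junta_amplitudeOne_value_le_of_sqrt :
    ∃ a : ℝ, 0 < a ∧ ∃ n₀ : ℕ, ∀ n : ℕ, n₀ ≤ n → Even n → ∀ {t : ℕ} {C : Finset ℕ} {w : ℕ → ℝ},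
    IsBalancedDesign n t (Tq n) (dq n) 20 C w →
    ∀ (H : Finset (Fin n)), 4 * H.card ≤ Nat.sqrt n →
    ∀ (f : Finset (Fin n) → ℝ) {G : ℝ}, (∀ I, |f I| ≤ G) → (∀ I, 0 ≤ f I) →
    ∀ {r m : ℕ} (β : Fin n → Matrix (Fin r) (Fin m) ℝ),
    (∀ U : OddSet n, U.1.card = t →
      (1 - (∑ p, (if p ∈ U.1 then (1 : ℝ) else 0) • β p) * (∑ p, (if p ∈ U.1 then (1 : ℝ) else 0) • β p)ᵀ).PosSemidef) →
    ∀ (Y : PMatch n → Matrix (Fin r) (Fin r) ℝ), (∀ M, (Y M).PosSemidef ∧ (1 - Y M).PosSemidef) →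
    ∑ U : OddSet n, ∑ M : PMatch n, levelWeight n t C w U M *
        (f (U.1 ∩ H) *
          ((∑ p, (if p ∈ U.1 then (1 : ℝ) else 0) • β p) * (∑ p, (if p ∈ U.1 then (1 : ℝ) else 0) • β p)ᵀ * Y M).trace) ≤
      8 * (20 * G * ((4 * (H.card : ℝ) + t + 5 * (Tq n) + 4) ^ 2 + ((H.card : ℝ) + 1) * (n : ℝ) ^ 2) *
          (1 / 3 : ℝ) ^ (dq n / 2 - 1) +
        160 * G * (n : ℝ) ^ 6 * Real.exp (-(a * dq n)) +
        60 * G * (n : ℝ) ^ 4 * Real.sqrt (∏ i ∈ range ((dq n - 4) / 2 + 1), ((2 * i + 1 : ℝ) / ((n : ℝ) - 2 * i)))) * r := by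
  obtain ⟨a, ha, n₀, h161⟩ := junta_amplitudeOne_value_le
  refine ⟨a, ha, max n₀ (324 * 324), ?_⟩
  intro n hn heven t C w hbal H hh4 f G hG hf0 r m β hβ Y hY
  have hn₀ : n₀ ≤ n := le_trans (le_max_left _ _) hn
  have hm : 324 ≤ Nat.sqrt n := by
    rw [Nat.le_sqrt]; exact le_trans (le_max_right _ _) hn
  have hn4 : n ≤ 4 * t := hbal.2
  have h2t : 2 * t + 2 ≤ n := hbal.1.2.1
  obtain ⟨s₀, hs₀⟩ := hbal.1.1
  obtain ⟨h9, hR1, hRa, hRb, hq, hθ⟩ := sqrt_block_admissible (n := n) (h := H.card) hs₀ hn4 h2t hh4 hm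
  exact h161 n hn₀ heven hbal H rfl h9 hs₀ hR1 hRa hRb hq hθ f hG hf0 β hβ Y hY

/-! ### §2 (CG_1′) for junta masks on small blocks in all directions, literal form -/

/-- **(CG_1′) FOR JUNTA MASKS ON SMALL BLOCKS, pair-symmetric fields.** There are `a > 0` and `n₀` such that for all even `n ≥ n₀`,
every balanced `B = 20` Chebyshev design `(t, C, w)`, every block `H` with `4|H| ≤ ⌊√n⌋`, every junta mask `0 ≤ f ≤ G` of
the in-set and every pair-symmetric direction field `c_M : [n] → [−1,1]`:
`Σ_M Σ_U W(U,M)·f(U∩H)·(Σ_p c_M(p) x_p x_{π_M p})² ≤ 20G((4h+t+5Tq n+4)² + (h+1)n²)(1/3)^{⌊dq n/2⌋−1} + 160Gn⁶e^{−a·dq n}`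
(`h = |H|`; brick 148 §4 with the identity colouring of `H` + brick J5a). [cite: Rothvoss2017, §2 and Lemma 7 (PDF pp. 5–8)]
[cite: KeevashLifshitz2023, Thm. 1.8] -/
theorem junta_allDirections_pairSymm_le :
    ∃ a : ℝ, 0 < a ∧ ∃ n₀ : ℕ, ∀ n : ℕ, n₀ ≤ n → Even n → ∀ {t : ℕ} {C : Finset ℕ} {w : ℕ → ℝ},
    IsBalancedDesign n t (Tq n) (dq n) 20 C w →
    ∀ (H : Finset (Fin n)), 4 * H.card ≤ Nat.sqrt n →
    ∀ (f : Finset (Fin n) → ℝ) {G : ℝ}, (∀ I, |f I| ≤ G) → (∀ I, 0 ≤ f I) →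
    ∀ (c : PMatch n → Fin n → ℝ), (∀ M p, |c M p| ≤ 1) → (∀ M p, c M (M.2.partner p) = c M p) →
    ∑ M : PMatch n, ∑ U : OddSet n, levelWeight n t C w U M *
        (f (U.1 ∩ H) *
          (∑ p : Fin n, c M p * ((if p ∈ U.1 then (1 : ℝ) else 0) * (if M.2.partner p ∈ U.1 then (1 : ℝ) else 0))) ^ 2) ≤
      20 * G * ((4 * (H.card : ℝ) + t + 5 * (Tq n) + 4) ^ 2 + ((H.card : ℝ) + 1) * (n : ℝ) ^ 2) *
          (1 / 3 : ℝ) ^ (dq n / 2 - 1) +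
        160 * G * (n : ℝ) ^ 6 * Real.exp (-(a * dq n)) := by
  classical
  obtain ⟨a, ha, n₁, hrung⟩ := rectangleDecayExp_all_holds
  refine ⟨a, ha, max n₁ (324 * 324), ?_⟩
  intro n hn heven t C w hbal H hh4 f G hG hf0 c hc hcπ
  have hn₁ : n₁ ≤ n := le_trans (le_max_left _ _) hn
  have hm : 324 ≤ Nat.sqrt n := by rw [Nat.le_sqrt]; exact le_trans (le_max_right _ _) hn
  have h256 : 256 ≤ n := le_trans (by norm_num) (le_trans (le_max_right _ _) hn)
  obtain ⟨hD4, hDT⟩ := dq_facts h256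
  have hdes : IsExactDesign n t (Tq n) (dq n) 20 C w := hbal.1
  have hG0 : 0 ≤ G := (abs_nonneg _).trans (hG ∅)
  have hN : (univ : Finset (Fin n)).card = 2 * (n / 2) := by
    rw [card_univ, Fintype.card_fin]; obtain ⟨k, hk⟩ := heven; omega
  have hn4 : n ≤ 4 * t := hbal.2
  have h2t : 2 * t + 2 ≤ n := hbal.1.2.1
  obtain ⟨s₀, hs₀⟩ := hbal.1.1
  obtain ⟨h9, hR1, hRa, hRb, hq, hθ⟩ := sqrt_block_admissible (n := n) (h := H.card) hs₀ hn4 h2t hh4 hm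
  have h2h : 2 * H.card ≤ n := by omega
  have hR := hrung n hn₁ heven t C w hbal
  obtain ⟨col, hc0, hcfix, htc⟩ := identityColour_facts H
  set fU : Finset (Fin n) → ℝ := fun U => f (U ∩ H) with hf
  have hf0' : ∀ U, 0 ≤ fU U := fun U => hf0 _
  have hfG : ∀ U, fU U ≤ G := fun U => (le_abs_self _).trans (hG _)
  have hfinv : ∀ (M : PMatch n) (g : Equiv.Perm (Fin n)), (∀ i, g (M.2.partner i) = M.2.partner (g i)) →
      (∀ i, col (g i) = col i) → ∀ U : Finset (Fin n), fU (U.map g.toEmbedding) = fU U := by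
    intro M g _ hg U
    rw [hf]
    simp only
    rw [hcfix g hg U]
  have h148 := colourSymmetric_allDirections_reduction hbal.1.1 C w hR col fU hG0 hf0' hfG hfinv c hc hcπ
  set v : PMatch n → Fin n → ℝ := fun M p =>
    (∑ q ∈ univ.filter (fun q => s(col q, col (M.2.partner q)) = s(col p, col (M.2.partner p))), c M q) /
      ((univ.filter fun q => s(col q, col (M.2.partner q)) = s(col p, col (M.2.partner p))).card : ℝ) with hvdef
  have hv1 : ∀ M p, |v M p| ≤ 1 := fun M p => abs_classAvg_le_one _ (c M) (hc M)
  have hvt : ∀ (M : PMatch n) p p', s(col p, col (M.2.partner p)) = s(col p', col (M.2.partner p')) → v M p = v M p' :=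
    fun M p p' hpp' => by simp only [hvdef, hpp']
  have h160 := tilted_designValue_avg_le_three_pow_J hdes hN H rfl h9 h2h hs₀ hD4 hDT hR1 hRa hRb hq hθ f hG hf0 v hv1
    (fun M => htc M.2.partner (v M) (hvt M))
  simp only [hf, hvdef] at h148 h160
  linarith [h148, h160]

/-- **(CG_1′) FOR JUNTA MASKS ON SMALL BLOCKS, LITERAL FORM (brick J5b).** For some `a > 0` and all large even `n`: every balanced
`B = 20` Chebyshev design, every block `H` with `4|H| ≤ ⌊√n⌋`, every junta mask `0 ≤ f ≤ G` of the in-set and EVERY direction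
field `v : PM_n → [n] → [−1,1]` satisfy
`Σ_M (Σ_U W(U,M)·f(U∩H)·(Σ_p v_M(p)·x_p x_{π_M p})²)₊ ≤ 20G((4h+t+5Tq n+4)² + (h+1)n²)(1/3)^{⌊dq n/2⌋−1} + 160Gn⁶e^{−a·dq n}`.
[cite: Rothvoss2017, §2 and Lemma 7 (PDF pp. 5–8)] [cite: KeevashLifshitz2023, Thm. 1.8] -/
theorem junta_containment_allDirections_decay :
    ∃ a : ℝ, 0 < a ∧ ∃ n₀ : ℕ, ∀ n : ℕ, n₀ ≤ n → Even n → ∀ {t : ℕ} {C : Finset ℕ} {w : ℕ → ℝ},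
    IsBalancedDesign n t (Tq n) (dq n) 20 C w →
    ∀ (H : Finset (Fin n)), 4 * H.card ≤ Nat.sqrt n →
    ∀ (f : Finset (Fin n) → ℝ) {G : ℝ}, (∀ I, |f I| ≤ G) → (∀ I, 0 ≤ f I) →
    ∀ (v : PMatch n → Fin n → ℝ), (∀ M p, |v M p| ≤ 1) →
    ∑ M : PMatch n, max (∑ U : OddSet n, levelWeight n t C w U M *
        (f (U.1 ∩ H) *
          (∑ p : Fin n, v M p * ((if p ∈ U.1 then (1 : ℝ) else 0) * (if M.2.partner p ∈ U.1 then (1 : ℝ) else 0))) ^ 2)) 0 ≤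
      20 * G * ((4 * (H.card : ℝ) + t + 5 * (Tq n) + 4) ^ 2 + ((H.card : ℝ) + 1) * (n : ℝ) ^ 2) *
          (1 / 3 : ℝ) ^ (dq n / 2 - 1) +
        160 * G * (n : ℝ) ^ 6 * Real.exp (-(a * dq n)) := by
  classical
  obtain ⟨a, ha, n₀, h161⟩ := junta_allDirections_pairSymm_le
  refine ⟨a, ha, n₀, ?_⟩
  intro n hn hev t C w hdes H hH f G hG hf0 v hv
  obtain ⟨c, hc⟩ : ∃ c : PMatch n → Fin n → ℝ, ∀ M p, c M p =
      if 0 ≤ ∑ U : OddSet n, levelWeight n t C w U M * (f (U.1 ∩ H) *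
          (∑ p : Fin n, v M p * ((if p ∈ U.1 then (1 : ℝ) else 0) * (if M.2.partner p ∈ U.1 then (1 : ℝ) else 0))) ^ 2)
      then (v M p + v M (M.2.partner p)) / 2 else 0 := ⟨_, fun _ _ => rfl⟩
  have hc1 : ∀ M p, |c M p| ≤ 1 := fun M p => by
    rw [hc]
    split_ifs
    · have h1 := abs_le.1 (hv M p); have h2 := abs_le.1 (hv M (M.2.partner p))
      rw [abs_le]; constructor <;> linarith
    · simp
  have hcπ : ∀ M p, c M (M.2.partner p) = c M p := fun M p => by
    rw [hc, hc, M.2.partner_partner]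
    split_ifs <;> ring
  have key := h161 n hn hev hdes H hH f hG hf0 c hc1 hcπ
  refine le_trans (le_of_eq (sum_congr rfl fun M _ => ?_)) key
  by_cases hpos : 0 ≤ ∑ U : OddSet n, levelWeight n t C w U M * (f (U.1 ∩ H) *
      (∑ p : Fin n, v M p * ((if p ∈ U.1 then (1 : ℝ) else 0) * (if M.2.partner p ∈ U.1 then (1 : ℝ) else 0))) ^ 2)
  · rw [max_eq_left hpos]
    refine Fintype.sum_congr _ _ fun U => ?_
    rw [containment_pairSymm M U.1 (v M)]
    congr 3
    refine sum_congr rfl fun p _ => ?_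
    rw [hc, if_pos hpos]
  · rw [max_eq_right (le_of_lt (lt_of_not_ge hpos))]
    symm
    refine sum_eq_zero fun U _ => ?_
    have : ∑ p : Fin n, c M p * ((if p ∈ U.1 then (1 : ℝ) else 0) * (if M.2.partner p ∈ U.1 then (1 : ℝ) else 0)) = 0 :=
      sum_eq_zero fun p _ => by rw [hc, if_neg hpos, zero_mul]
    rw [this]; ring

end Summit.PneNP.PneNP.Theorems.ChebyshevTracialDesignTiltedJuntaRungs

end
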